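import Literature.InformationTheory.Entropy.MapEntropySubadditivity
import HarnessLib

/-!
# The chain rule in fibre form and strong subadditivity for `mapEntropy`

For the entropy `mapEntropy S F = H(F(U_S))` of the image of the uniform distribution on a finite
set `S` (`Literature/InformationTheory/Entropy/MapEntropy.lean`):

* `fiber_pair_eq_fiber_fiber` — the fibre of the pair map `(f, g)` through `v` is the fibre of `f`
  inside the fibre of `g`;
* `mapEntropy_pair_eq_add_sum_fiber` — the **chain rule** `H(f, g) = H(g) + H(f | g)` with the
  conditional entropy written as the fibre average
  `H(f | g) = (1/|S|) ∑_{y ∈ g(S)} |g⁻¹(y)| · H(f(U_{g⁻¹(y)}))` (Cover–Thomas, Thm 2.2.1 and (2.10));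
* `mapEntropy_le_mapEntropy_pair` — monotonicity `H(g) ≤ H(f, g)` (conditional entropy is `≥ 0`);
* `mapEntropy_pair_strong_subadditivity` — **strong subadditivity** / "conditioning reduces
  entropy": `H((f, g), h) + H(h) ≤ H(f, h) + H(g, h)` (Cover–Thomas, Thm 2.6.5 and (2.157)),
  obtained by applying plain subadditivity (`mapEntropy_prod_le`) on every fibre of `h` and
  averaging with the chain rule.

These are the two facts that turn `mapEntropy` into a usable Shannon calculus (conditional entropy
and conditional mutual information as differences of joint entropies, both monotone). No new
definitions; conditional quantities are kept as explicit differences/averages. Appended: symmetry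
of joint entropy, `H(f, g) = H(g)` for `f` determined by `g`, data processing in one component.

## References

* T. M. Cover, J. A. Thomas, *Elements of Information Theory*, 2nd ed., Wiley 2006: Thm 2.2.1
  (chain rule), (2.10) (conditional entropy as an average over the conditioning value),
  Thm 2.6.5 ("conditioning reduces entropy"), (2.157) (strong subadditivity form).
-/

namespace Literature.InformationTheory.Entropy

open Finset

variable {ι β β' β'' : Type*} [DecidableEq β] [DecidableEq β'] [DecidableEq β'']

/-- The fibre of the pair map `v ↦ (f v, g v)` through a point is the fibre of `f` inside the fibre
of `g` (private helper for the chain rule). [cite: CoverThomas2006, Thm 2.2.1] -/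
theorem fiber_pair_eq_fiber_fiber (S : Finset ι) (f : ι → β) (g : ι → β') (v : ι) :
    fiber S (fun w => (f w, g w)) (f v, g v) = fiber (fiber S g (g v)) f (f v) := by
  ext w
  simp only [mem_fiber, Prod.mk.injEq]
  tauto

/-- Unnormalised form of the chain rule: summing the surprises of the pair map over `S` splits into
the surprises of `g` plus, fibre by fibre, `|g⁻¹(y)|` times the entropy of `f` on that fibre
(the chain rule `H(X,Y) = H(X) + H(Y|X)` before dividing by `|S|`). [cite: CoverThomas2006, Thm 2.2.1] -/
theorem sum_logb_fiber_pair (S : Finset ι) (f : ι → β) (g : ι → β') :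
    ∑ v ∈ S, Real.logb 2 ((S.card : ℝ) / (fiber S (fun w => (f w, g w)) (f v, g v)).card) =
      ∑ v ∈ S, Real.logb 2 ((S.card : ℝ) / (fiber S g (g v)).card) +
      ∑ y ∈ S.image g, ((fiber S g y).card : ℝ) * mapEntropy (fiber S g y) f := by
  -- pointwise splitting of the surprise
  have hsplit : ∀ v ∈ S,
      Real.logb 2 ((S.card : ℝ) / (fiber S (fun w => (f w, g w)) (f v, g v)).card) =
        Real.logb 2 ((S.card : ℝ) / (fiber S g (g v)).card) +
        Real.logb 2 (((fiber S g (g v)).card : ℝ) / (fiber (fiber S g (g v)) f (f v)).card) := by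
    intro v hv
    have hS : (0 : ℝ) < S.card := by exact_mod_cast Finset.card_pos.mpr ⟨v, hv⟩
    have hG : (0 : ℝ) < (fiber S g (g v)).card := by exact_mod_cast card_fiber_pos g hv
    have hF : (0 : ℝ) < (fiber (fiber S g (g v)) f (f v)).card := by
      exact_mod_cast card_fiber_pos f (self_mem_fiber g hv)
    rw [fiber_pair_eq_fiber_fiber, ← Real.logb_mul (div_pos hS hG).ne' (div_pos hG hF).ne']
    congr 1
    field_simp
  rw [Finset.sum_congr rfl hsplit, Finset.sum_add_distrib]
  congr 1
  -- regroup the second sum along the fibres of `g`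
  rw [← Finset.sum_fiberwise_of_maps_to (s := S) (t := S.image g) (g := g)
    (fun v hv => Finset.mem_image_of_mem g hv)]
  refine Finset.sum_congr rfl fun y hy => ?_
  -- on the fibre over `y`, `g w = y`
  have hfib : ∀ w ∈ S.filter (fun w => g w = y), fiber S g (g w) = fiber S g y := by
    intro w hw
    rw [(Finset.mem_filter.mp hw).2]
  have hset : S.filter (fun w => g w = y) = fiber S g y := rfl
  rw [Finset.sum_congr rfl fun w hw => by rw [hfib w hw], hset]
  -- `|F| · mapEntropy F f = ∑_{w ∈ F} log (|F| / |fiber F f (f w)|)`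
  obtain ⟨v, hv, rfl⟩ := Finset.mem_image.mp hy
  have hG : ((fiber S g (g v)).card : ℝ) ≠ 0 := by
    exact_mod_cast (card_fiber_pos g hv).ne'
  unfold mapEntropy
  rw [mul_div_cancel₀ _ hG]

/-- **CHAIN RULE (fibre form).** `H(f, g) = H(g) + (1/|S|) ∑_{y ∈ g(S)} |g⁻¹(y)| · H_{g⁻¹(y)}(f)`:
the entropy of the pair is the entropy of `g` plus the conditional entropy of `f` given `g`, the
latter being the average over the fibres of `g` (weighted by their size) of the entropy of `f`
restricted to the fibre. [cite: CoverThomas2006, Thm 2.2.1] -/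
theorem mapEntropy_pair_eq_add_sum_fiber (S : Finset ι) (f : ι → β) (g : ι → β') :
    mapEntropy S (fun v => (f v, g v)) =
      mapEntropy S g + (∑ y ∈ S.image g, ((fiber S g y).card : ℝ) * mapEntropy (fiber S g y) f) /
        S.card := by
  unfold mapEntropy
  rw [sum_logb_fiber_pair, add_div]
  rfl

/-- Conditional entropy is non-negative: `H(g) ≤ H(f, g)` (`H(Y|X) ≥ 0`). [cite: CoverThomas2006, Lemma 2.1.1] -/
theorem mapEntropy_le_mapEntropy_pair (S : Finset ι) (f : ι → β) (g : ι → β') :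
    mapEntropy S g ≤ mapEntropy S (fun v => (f v, g v)) := by
  rw [mapEntropy_pair_eq_add_sum_fiber]
  refine le_add_of_nonneg_right (div_nonneg (Finset.sum_nonneg fun y _ => ?_) (Nat.cast_nonneg _))
  exact mul_nonneg (Nat.cast_nonneg _) (mapEntropy_nonneg _ _)

/-- **STRONG SUBADDITIVITY / conditioning reduces entropy.**
`H((f, g), h) + H(h) ≤ H(f, h) + H(g, h)`, i.e. `H(f, g | h) ≤ H(f | h) + H(g | h)`, i.e.
`H(f | g, h) ≤ H(f | h)`, i.e. `I(f ; g | h) ≥ 0`: apply subadditivity (`mapEntropy_prod_le`) on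
each fibre of `h` and average with the chain rule. [cite: CoverThomas2006, Thm 2.6.5] -/
theorem mapEntropy_pair_strong_subadditivity (S : Finset ι) (f : ι → β) (g : ι → β')
    (h : ι → β'') :
    mapEntropy S (fun v => ((f v, g v), h v)) + mapEntropy S h ≤
      mapEntropy S (fun v => (f v, h v)) + mapEntropy S (fun v => (g v, h v)) := by
  rw [mapEntropy_pair_eq_add_sum_fiber S (fun v => (f v, g v)) h,
    mapEntropy_pair_eq_add_sum_fiber S f h, mapEntropy_pair_eq_add_sum_fiber S g h]
  have hfib : ∀ y ∈ S.image h,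
      ((fiber S h y).card : ℝ) * mapEntropy (fiber S h y) (fun v => (f v, g v)) ≤
        ((fiber S h y).card : ℝ) * mapEntropy (fiber S h y) f +
        ((fiber S h y).card : ℝ) * mapEntropy (fiber S h y) g := by
    intro y _
    rw [← mul_add]
    exact mul_le_mul_of_nonneg_left (mapEntropy_prod_le _ f g) (Nat.cast_nonneg _)
  have hsum := Finset.sum_le_sum hfib
  rw [Finset.sum_add_distrib] at hsum
  have hdiv := div_le_div_of_nonneg_right hsum (Nat.cast_nonneg S.card)
  rw [add_div] at hdiv
  linarith

/-- Conditioning reduces entropy, difference form: `H(f, (g, h)) − H(g, h) ≤ H(f, h) − H(h)`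
(`H(f | g, h) ≤ H(f | h)`, "conditioning reduces entropy"). [cite: CoverThomas2006, Thm 2.6.5] -/
theorem mapEntropy_pair_sub_le_pair_sub (S : Finset ι) (f : ι → β) (g : ι → β') (h : ι → β'') :
    mapEntropy S (fun v => (f v, (g v, h v))) - mapEntropy S (fun v => (g v, h v)) ≤
      mapEntropy S (fun v => (f v, h v)) - mapEntropy S h := by
  have hssa := mapEntropy_pair_strong_subadditivity S f g h
  -- re-associate the triple
  have hassoc : mapEntropy S (fun v => (f v, (g v, h v))) =
      mapEntropy S (fun v => ((f v, g v), h v)) := by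
    have : (fun v => (f v, (g v, h v))) =
        (fun p : (β × β') × β'' => (p.1.1, (p.1.2, p.2))) ∘ (fun v => ((f v, g v), h v)) := rfl
    rw [this, mapEntropy_comp_of_injOn]
    intro a _ b _ hab
    simp only [Prod.mk.injEq] at hab
    simp [hab.1, hab.2.1, hab.2.2]
  linarith

/-! ### Elementary bookkeeping for joint entropies (appended) -/

/-- `H(f, g) = H(g, f)`: the joint entropy is symmetric (swapping the components is injective on
outputs). [cite: CoverThomas2006, Thm 2.2.1] -/
theorem mapEntropy_pair_comm (S : Finset ι) (f : ι → β) (g : ι → β') :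
    mapEntropy S (fun v => (f v, g v)) = mapEntropy S (fun v => (g v, f v)) := by
  have : (fun v => (g v, f v)) = Prod.swap ∘ (fun v => (f v, g v)) := rfl
  rw [this, mapEntropy_comp_of_injOn]
  intro a _ b _ hab
  simpa [Prod.swap, Prod.mk.injEq, and_comm] using hab

/-- `H(f, g) = H(g)` when `f` is determined by `g` on `S` (`H(f | g) = 0` for `f` a function of
`g`): the fibres of the pair map and of `g` coincide. [cite: CoverThomas2006, Thm 2.2.1] -/
theorem mapEntropy_pair_eq_right_of_determined (S : Finset ι) (f : ι → β) (g : ι → β')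
    (hdet : ∀ v ∈ S, ∀ w ∈ S, g v = g w → f v = f w) :
    mapEntropy S (fun v => (f v, g v)) = mapEntropy S g := by
  unfold mapEntropy
  congr 1
  refine Finset.sum_congr rfl fun v hv => ?_
  have hfib : fiber S (fun w => (f w, g w)) (f v, g v) = fiber S g (g v) := by
    ext w
    simp only [mem_fiber, Prod.mk.injEq]
    constructor
    · rintro ⟨hw, -, hgw⟩; exact ⟨hw, hgw⟩
    · rintro ⟨hw, hgw⟩; exact ⟨hw, hdet w hw v hv hgw, hgw⟩
  rw [hfib]

/-- Data processing inside a joint entropy: `H(φ ∘ f, g) ≤ H(f, g)`.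
[cite: CoverThomas2006, Problem 2.4] -/
theorem mapEntropy_pair_comp_left_le {γ : Type*} [DecidableEq γ] (S : Finset ι) (f : ι → β)
    (g : ι → β') (φ : β → γ) :
    mapEntropy S (fun v => (φ (f v), g v)) ≤ mapEntropy S (fun v => (f v, g v)) := by
  have : (fun v => (φ (f v), g v)) = (Prod.map φ id) ∘ (fun v => (f v, g v)) := rfl
  rw [this]
  exact mapEntropy_comp_le S _ _

/-- Conditional entropy of a determined quantity vanishes, difference form: if `f` is determined by
`g` on `S` then `H(f, (g, h)) = H(g, h)` for every further `h`. [cite: CoverThomas2006, Thm 2.2.1] -/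
theorem mapEntropy_pair_pair_eq_of_determined (S : Finset ι) (f : ι → β) (g : ι → β') (h : ι → β'')
    (hdet : ∀ v ∈ S, ∀ w ∈ S, g v = g w → f v = f w) :
    mapEntropy S (fun v => (f v, (g v, h v))) = mapEntropy S (fun v => (g v, h v)) :=
  mapEntropy_pair_eq_right_of_determined S f (fun v => (g v, h v))
    (fun v hv w hw hgh => hdet v hv w hw (congrArg Prod.fst hgh))

end Literature.InformationTheory.Entropy
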